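import Summits.CriticalPhenomena.CardyFormulaZ2.Theorems.CardyBoundaryCoulombGasBoundaryDefectGaussianRStubClusterLocalityV2Part6

/-!
# Stub `stub_clusterLocalityV2` of line `rainbow-monomials-in-excursion-kernels` — Part 7:
# Green-function locality at a flat boundary stretch (the Green half G1 of cluster locality)
# (crux `BoundaryDefectGaussianR`, stmt-CriticalPhenomena-14132)

The GREEN HALF of the corrected cluster-locality stub `stub_clusterLocalityV2`: if two finite
domains `V, V' ⊆ ℤ²` are FLAT (equal to the discrete upper half-plane `{v₁ ≥ a₁}`, resp.
`{v₁ ≥ a'₁}`) in the balls of radius `M·m` about anchors `a, a'`, and `x, y` are points of the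
anchor row within horizontal distance `m ≥ 1` of `a`, then the Dirichlet Green functions
(`Literature.Probability.LatticeModels.dirichletGreen`, normalisation `G = (4 - A)⁻¹`) at the
pair `(x, y)` and at the translated pair `(x', y') = (x - a + a', y - a + a')` are positive and

  `|log G_V(x, y) - log G_{V'}(x', y')| ≤ C/M²`   for `M ≥ C`,

with an absolute constant `C` — uniformly in `m ≥ 1`, in the position of the points, and in
`V, V'` beyond the flat balls (`green_locality`, registered sub-goal `s10_greenLocality`). In the
stub, this controls the Coulomb-gas sum `∑_{i<i'} (-e_i e_{i'}/6) log G_V(p_i, p_{i'})` of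
`F_V(p)`; the complementary PERCOLATION half (locality of `‖Zins‖/‖Z‖`, via the insertion
dictionary) is not addressed here.

Proof: Parts 1–6. With `k = max(|x₀ - y₀|, 1) ≤ 2m + 1` and `N = ⌊Mm/20⌋ ≥ 816k`, both
`G_V(x,y)` and `G_{V'}(x',y')` are within `48(50k+1)²/(c₁N(N+k+1)) ≤ C₀/M²` in logarithm of
the Green function of the half-box of size `N + k` at `x` (resp. its translate at `x'`, which has
the same Green function by translation covariance), `flat_box_hypotheses` converting ball-flatness
into the box hypotheses of Part 6.

All statements are folklore lattice potential theory (Lawler–Limic 2010, §6.2–6.3, §8.1).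
-/

noncomputable section

namespace Summit.CriticalPhenomena.CardyFormulaZ2.Cruxes.BoundaryDefectGaussianR.RainbowMonomialsInExcursionKernels

open Finset Literature.Probability.LatticeModels

/-! ### From ball-flatness to the box hypotheses -/

/-- Two coordinates bounded by `P` in absolute value lie in the disc of radius `R` as soon as
`2P² ≤ R²`. [folklore] -/
theorem sq_add_sq_le_of_abs_le {u v P R : ℝ} (hu : |u| ≤ P) (hv : |v| ≤ P)
    (hP : 2 * P ^ 2 ≤ R ^ 2) : u ^ 2 + v ^ 2 ≤ R ^ 2 := by
  have h1 : u ^ 2 ≤ P ^ 2 := sq_le_sq' (abs_le.1 hu).1 (abs_le.1 hu).2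
  have h2 : v ^ 2 ≤ P ^ 2 := sq_le_sq' (abs_le.1 hv).1 (abs_le.1 hv).2
  linarith

/-- **Ball-flatness gives the box hypotheses.** If `V` agrees with the upper half-plane
`{v₁ ≥ a₁}` on the disc of radius `R` about `a`, `x, y` lie on the row of `a` within horizontal
distance `m` of `a`, and `2(9N + k + m + 1)² ≤ R²`, then: the half-box of size `N + k` at `x`
lies in `V` and the row below it outside `V`; the half-box of size `8N` at `y` lies in `V` and
the row below it outside `V`. [folklore] -/
theorem flat_box_hypotheses {V : Finset (Site 2)} {a x y : Site 2} {m R : ℝ} {k N : ℕ}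
    (hflat : ∀ v : Site 2, (((v 0 - a 0) ^ 2 + (v 1 - a 1) ^ 2 : ℤ) : ℝ) ≤ R ^ 2 →
      (v ∈ V ↔ a 1 ≤ v 1))
    (hx1 : x 1 = a 1) (hy1 : y 1 = a 1)
    (hxa : |((x 0 : ℝ) - a 0)| ≤ m) (hya : |((y 0 : ℝ) - a 0)| ≤ m)
    (hP : 2 * (9 * (N : ℝ) + k + m + 1) ^ 2 ≤ R ^ 2) :
    (∀ v : Site 2, x 0 - (N + k : ℕ) ≤ v 0 → v 0 ≤ x 0 + (N + k : ℕ) → x 1 ≤ v 1 →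
      v 1 ≤ x 1 + (N + k : ℕ) → v ∈ V) ∧
    (∀ v : Site 2, x 0 - (N + k : ℕ) ≤ v 0 → v 0 ≤ x 0 + (N + k : ℕ) → v 1 = x 1 - 1 → v ∉ V) ∧
    (∀ v : Site 2, y 0 - 8 * N ≤ v 0 → v 0 ≤ y 0 + 8 * N → y 1 ≤ v 1 →
      v 1 ≤ y 1 + 8 * N → v ∈ V) ∧
    (∀ v : Site 2, y 0 - 8 * N ≤ v 0 → v 0 ≤ y 0 + 8 * N → v 1 = y 1 - 1 → v ∉ V) := by
  set P : ℝ := 9 * (N : ℝ) + k + m + 1 with hPdef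
  have hm0 : 0 ≤ m := le_trans (abs_nonneg _) hxa
  have hN0 : (0 : ℝ) ≤ N := by positivity
  have hk0 : (0 : ℝ) ≤ k := by positivity
  have hball : ∀ v : Site 2, |((v 0 : ℝ) - a 0)| ≤ P → |((v 1 : ℝ) - a 1)| ≤ P →
      (v ∈ V ↔ a 1 ≤ v 1) := fun v h0 h1 =>
    hflat v (by push_cast; exact sq_add_sq_le_of_abs_le h0 h1 hP)
  -- integer bounds to real absolute values
  have habs : ∀ (p q : ℤ) (B : ℕ), p - q ≤ B → q - p ≤ B → |((p : ℝ) - q)| ≤ B := by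
    intro p q B h1 h2
    rw [abs_sub_le_iff]
    exact ⟨by exact_mod_cast h1, by exact_mod_cast h2⟩
  -- horizontal control via the triangle inequality through `x` or `y`
  have hvia : ∀ (v c : Site 2) (B : ℕ), |((c 0 : ℝ) - a 0)| ≤ m → v 0 - c 0 ≤ B →
      c 0 - v 0 ≤ B → (B : ℝ) ≤ 9 * N + k + 1 → |((v 0 : ℝ) - a 0)| ≤ P := by
    intro v c B hc h1 h2 hB
    have := abs_sub_le ((v 0 : ℝ)) (c 0) (a 0)
    have := habs (v 0) (c 0) B h1 h2
    rw [hPdef]; linarith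
  have hvert : ∀ (v : Site 2) (B : ℕ), v 1 - a 1 ≤ B → a 1 - v 1 ≤ B →
      (B : ℝ) ≤ 9 * N + k + 1 → |((v 1 : ℝ) - a 1)| ≤ P := by
    intro v B h1 h2 hB
    have := habs (v 1) (a 1) B h1 h2
    rw [hPdef]; linarith
  have hNk : (((N + k : ℕ) : ℝ)) ≤ 9 * N + k + 1 := by push_cast; linarith
  have h8N : (((8 * N : ℕ) : ℝ)) ≤ 9 * N + k + 1 := by push_cast; linarith
  have h1' : (((1 : ℕ) : ℝ)) ≤ 9 * N + k + 1 := by push_cast; linarith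
  refine ⟨fun v h1 h2 h3 h4 => ?_, fun v h1 h2 h3 hv => ?_, fun v h1 h2 h3 h4 => ?_,
    fun v h1 h2 h3 hv => ?_⟩
  · exact (hball v (hvia v x (N + k) hxa (by omega) (by omega) hNk)
      (hvert v (N + k) (by omega) (by omega) hNk)).2 (by omega)
  · have := (hball v (hvia v x (N + k) hxa (by omega) (by omega) hNk)
      (hvert v 1 (by push_cast; omega) (by push_cast; omega) h1')).1 hv
    omega
  · exact (hball v (hvia v y (8 * N) hya (by push_cast; omega) (by push_cast; omega) h8N)
      (hvert v (8 * N) (by push_cast; omega) (by push_cast; omega) h8N)).2 (by omega)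
  · have := (hball v (hvia v y (8 * N) hya (by push_cast; omega) (by push_cast; omega) h8N)
      (hvert v 1 (by push_cast; omega) (by push_cast; omega) h1')).1 hv
    omega

/-- **Locality with respect to the half-box, under ball-flatness.** With the notation of
`flat_box_hypotheses`, `k ≥ 1`, `N ≥ 816k`, `|x₀ - y₀| ≤ k` and `Q` the half-box of size `N + k`
at `x`: `G_Q(x,y) > 0`, `G_V(x,y) > 0` and
`|log G_V(x,y) - log G_Q(x,y)| ≤ 48(50k+1)²/(c₁ N (N+k+1))`. [folklore] -/
theorem abs_log_dirichletGreen_sub_of_flat {V Q : Finset (Site 2)} {a x y : Site 2} {m R : ℝ}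
    {k N : ℕ} (hk : 1 ≤ k) (hN : 816 * k ≤ N)
    (hflat : ∀ v : Site 2, (((v 0 - a 0) ^ 2 + (v 1 - a 1) ^ 2 : ℤ) : ℝ) ≤ R ^ 2 →
      (v ∈ V ↔ a 1 ≤ v 1))
    (hx1 : x 1 = a 1) (hy1 : y 1 = a 1)
    (hxa : |((x 0 : ℝ) - a 0)| ≤ m) (hya : |((y 0 : ℝ) - a 0)| ≤ m)
    (hxy : |x 0 - y 0| ≤ k) (hP : 2 * (9 * (N : ℝ) + k + m + 1) ^ 2 ≤ R ^ 2)
    (hQ : ∀ v : Site 2, v ∈ Q ↔ (x 0 - (N + k : ℕ) ≤ v 0 ∧ v 0 ≤ x 0 + (N + k : ℕ)) ∧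
      (x 1 ≤ v 1 ∧ v 1 ≤ x 1 + (N + k : ℕ))) :
    0 < dirichletGreen Q x y ∧ 0 < dirichletGreen V x y ∧
      |Real.log (dirichletGreen V x y) - Real.log (dirichletGreen Q x y)| ≤
        48 * (50 * (k : ℝ) + 1) ^ 2 / (15 / 152 * (maneuverConst / 2) ^ 18 *
          ((N : ℝ) * (((N + k : ℕ) : ℝ) + 1))) := by
  obtain ⟨hin, hout, hinY, houtY⟩ := flat_box_hypotheses hflat hx1 hy1 hxa hya hP
  have hQV : Q ⊆ V := fun v hv => by
    rw [hQ] at hv; exact hin v hv.1.1 hv.1.2 hv.2.1 hv.2.2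
  exact abs_log_dirichletGreen_sub_le hk hN hQ hQV hout hinY houtY (by rw [hy1, hx1]) hxy

/-! ### Translation covariance of the half-box Green function -/

/-- The translate of a half-rectangle is the half-rectangle at the translated base point, and
the Green function is translation covariant (`dirichletGreen_translate`). [folklore] -/
theorem exists_halfRect_translate {Q : Finset (Site 2)} {x : Site 2} {n T : ℕ}
    (hQ : ∀ v : Site 2, v ∈ Q ↔ (x 0 - n ≤ v 0 ∧ v 0 ≤ x 0 + n) ∧ (x 1 ≤ v 1 ∧ v 1 ≤ x 1 + T))
    (t y : Site 2) :
    ∃ Q' : Finset (Site 2), (∀ v : Site 2, v ∈ Q' ↔ ((x + t) 0 - n ≤ v 0 ∧ v 0 ≤ (x + t) 0 + n) ∧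
      ((x + t) 1 ≤ v 1 ∧ v 1 ≤ (x + t) 1 + T)) ∧
      dirichletGreen Q' (x + t) (y + t) = dirichletGreen Q x y := by
  refine ⟨Q.map (Site.shift t).toEmbedding, fun v => ?_,
    dirichletGreen_translate (by norm_num) Q t x y⟩
  rw [Finset.mem_map_equiv, Site.shift_symm_apply, hQ]
  simp only [Pi.sub_apply, Pi.add_apply]
  omega

/-! ### G1: Green-function locality -/

/-- **G1 — Green-function locality at a flat boundary stretch.** There is an absolute constant
`C > 0` such that for all finite `V, V' ⊆ ℤ²`, anchors `a, a'`, row points `x, y` and reals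
`m ≥ 1`, `M ≥ C`: if `V` (resp. `V'`) coincides with `{v₁ ≥ a₁}` (resp. `{v₁ ≥ a'₁}`) on the
disc of radius `M·m` about `a` (resp. `a'`), `x₁ = y₁ = a₁` and `|x₀ - a₀|, |y₀ - a₀| ≤ m`, then
`G_V(x,y) > 0`, `G_{V'}(x - a + a', y - a + a') > 0` and
`|log G_V(x,y) - log G_{V'}(x - a + a', y - a + a')| ≤ C/M²`. [folklore] -/
theorem green_locality : ∃ C : ℝ, 0 < C ∧ ∀ (V V' : Finset (Site 2)) (a a' x y : Site 2)
    (m M : ℝ), 1 ≤ m → C ≤ M →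
    (∀ v : Site 2, (((v 0 - a 0) ^ 2 + (v 1 - a 1) ^ 2 : ℤ) : ℝ) ≤ (M * m) ^ 2 →
      (v ∈ V ↔ a 1 ≤ v 1)) →
    (∀ v : Site 2, (((v 0 - a' 0) ^ 2 + (v 1 - a' 1) ^ 2 : ℤ) : ℝ) ≤ (M * m) ^ 2 →
      (v ∈ V' ↔ a' 1 ≤ v 1)) →
    x 1 = a 1 → y 1 = a 1 → (((x 0 - a 0) ^ 2 : ℤ) : ℝ) ≤ m ^ 2 →
    (((y 0 - a 0) ^ 2 : ℤ) : ℝ) ≤ m ^ 2 →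
    0 < dirichletGreen V x y ∧ 0 < dirichletGreen V' (x - a + a') (y - a + a') ∧
      |Real.log (dirichletGreen V x y) -
        Real.log (dirichletGreen V' (x - a + a') (y - a + a'))| ≤ C / M ^ 2 := by
  set c₁ : ℝ := 15 / 152 * (maneuverConst / 2) ^ 18 with hc₁
  have hc₁pos : 0 < c₁ := by have := maneuverConst_pos; positivity
  set C₀ : ℝ := 48 * 151 ^ 2 * 1600 / c₁ with hC₀
  have hC₀nn : 0 ≤ C₀ := by positivity
  refine ⟨48980 + 2 * C₀, by positivity, ?_⟩
  intro V V' a a' x y m M hm hM hV hV' hx1 hy1 hxa hya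
  have hM' : 48980 ≤ M := by linarith
  have hMpos : 0 < M := by linarith
  set R : ℝ := M * m with hR
  have hRm : 48980 * m ≤ R := by rw [hR]; nlinarith
  have hm0 : 0 ≤ m := by linarith
  -- horizontal distances to the anchor
  have habs_of_sq : ∀ u : ℝ, u ^ 2 ≤ m ^ 2 → |u| ≤ m := fun u hu => by
    rw [← Real.sqrt_sq_eq_abs, ← Real.sqrt_sq hm0]
    exact Real.sqrt_le_sqrt hu
  have hxa' : |((x 0 : ℝ) - a 0)| ≤ m := habs_of_sq _ (by push_cast at hxa; exact hxa)
  have hya' : |((y 0 : ℝ) - a 0)| ≤ m := habs_of_sq _ (by push_cast at hya; exact hya)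
  -- the separation scale `k`
  set k : ℕ := max (x 0 - y 0).natAbs 1 with hkdef
  have hk : 1 ≤ k := le_max_right _ _
  have hxyk : |x 0 - y 0| ≤ k := by
    rw [hkdef, ← Int.natCast_natAbs]; exact_mod_cast le_max_left _ _
  have hkm : (k : ℝ) ≤ 2 * m + 1 := by
    have h1 : k ≤ (x 0 - y 0).natAbs + 1 := by rw [hkdef]; omega
    have h2 : (((x 0 - y 0).natAbs : ℕ) : ℝ) = |((x 0 : ℝ) - y 0)| := by
      rw [Nat.cast_natAbs, Int.cast_abs, Int.cast_sub]
    have h3 : |((x 0 : ℝ) - y 0)| ≤ 2 * m := by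
      have := abs_sub_le ((x 0 : ℝ)) (a 0) (y 0)
      rw [abs_sub_comm ((a 0 : ℝ))] at this
      linarith
    have h4 : (k : ℝ) ≤ ((x 0 - y 0).natAbs : ℝ) + 1 := by exact_mod_cast h1
    linarith
  -- the truncation scale `N`
  set N : ℕ := ⌊R / 20⌋₊ with hNdef
  have hR0 : 0 ≤ R / 20 := by positivity
  have hN1 : (N : ℝ) ≤ R / 20 := Nat.floor_le hR0
  have hN2 : R / 20 < N + 1 := Nat.lt_floor_add_one _
  have hkN : 816 * k ≤ N := by
    have h : ((816 * k : ℕ) : ℝ) < N := by push_cast; nlinarith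
    exact_mod_cast h.le
  have hN40 : R ≤ 40 * N := by nlinarith
  -- the ball condition
  have hP : 2 * (9 * (N : ℝ) + k + m + 1) ^ 2 ≤ R ^ 2 := by
    have hle : 9 * (N : ℝ) + k + m + 1 ≤ R / 2 := by nlinarith
    have h0 : 0 ≤ 9 * (N : ℝ) + k + m + 1 := by positivity
    nlinarith
  -- the half-box at `x` and its translate at `x' = x + (a' - a)`
  obtain ⟨Q, hQ⟩ := exists_halfRect x (N + k) (N + k)
  set t : Site 2 := a' - a with ht
  obtain ⟨Q', hQ', heq⟩ := exists_halfRect_translate hQ t y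
  have ex : x - a + a' = x + t := by rw [ht]; abel
  have ey : y - a + a' = y + t := by rw [ht]; abel
  rw [ex, ey]
  -- locality for `V` and for `V'`
  obtain ⟨hgQ, hgV, hlogV⟩ := abs_log_dirichletGreen_sub_of_flat hk hkN hV hx1 hy1 hxa' hya'
    hxyk hP hQ
  have hx1' : (x + t) 1 = a' 1 := by simp [ht, hx1]
  have hy1' : (y + t) 1 = a' 1 := by simp [ht, hy1]
  have hxa'' : |(((x + t) 0 : ℝ) - a' 0)| ≤ m := by
    have e : (((x + t) 0 : ℝ) - a' 0) = (x 0 : ℝ) - a 0 := by simp [ht]; ring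
    rw [e]; exact hxa'
  have hya'' : |(((y + t) 0 : ℝ) - a' 0)| ≤ m := by
    have e : (((y + t) 0 : ℝ) - a' 0) = (y 0 : ℝ) - a 0 := by simp [ht]; ring
    rw [e]; exact hya'
  have hxyk' : |(x + t) 0 - (y + t) 0| ≤ k := by simpa using hxyk
  obtain ⟨hgQ', hgV', hlogV'⟩ := abs_log_dirichletGreen_sub_of_flat hk hkN hV' hx1' hy1' hxa''
    hya'' hxyk' hP hQ'
  rw [heq] at hlogV'
  refine ⟨hgV, hgV', ?_⟩
  -- the common bound `B ≤ C₀/M²`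
  set B : ℝ := 48 * (50 * (k : ℝ) + 1) ^ 2 / (c₁ * ((N : ℝ) * (((N + k : ℕ) : ℝ) + 1))) with hB
  have hNpos : (0 : ℝ) < N := by
    have : (816 : ℝ) ≤ N := by exact_mod_cast (show 816 ≤ N by omega)
    linarith
  have hBle : B ≤ C₀ / M ^ 2 := by
    rw [hB, hC₀, div_le_div_iff₀ (by positivity) (by positivity)]
    have h1 : 50 * (k : ℝ) + 1 ≤ 151 * m := by linarith
    have h2 : (48 * (50 * (k : ℝ) + 1) ^ 2) * M ^ 2 ≤ 48 * (151 * m) ^ 2 * M ^ 2 := by gcongr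
    have h3 : 48 * (151 * m) ^ 2 * M ^ 2 = 48 * 151 ^ 2 * R ^ 2 := by rw [hR]; ring
    have h4 : R ^ 2 ≤ (40 * (N : ℝ)) ^ 2 := by gcongr
    have h5 : (N : ℝ) ^ 2 ≤ (N : ℝ) * (((N + k : ℕ) : ℝ) + 1) := by
      rw [sq]
      refine mul_le_mul_of_nonneg_left ?_ hNpos.le
      push_cast; linarith
    have h6 : R ^ 2 ≤ 1600 * ((N : ℝ) * (((N + k : ℕ) : ℝ) + 1)) := by
      calc R ^ 2 ≤ (40 * (N : ℝ)) ^ 2 := h4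
        _ = 1600 * (N : ℝ) ^ 2 := by ring
        _ ≤ 1600 * ((N : ℝ) * (((N + k : ℕ) : ℝ) + 1)) := by linarith
    calc 48 * (50 * (k : ℝ) + 1) ^ 2 * M ^ 2 ≤ 48 * 151 ^ 2 * R ^ 2 := by rw [← h3]; exact h2
      _ ≤ 48 * 151 ^ 2 * (1600 * ((N : ℝ) * (((N + k : ℕ) : ℝ) + 1))) :=
          mul_le_mul_of_nonneg_left h6 (by positivity)
      _ = 48 * 151 ^ 2 * 1600 / c₁ * (c₁ * ((N : ℝ) * (((N + k : ℕ) : ℝ) + 1))) := by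
          field_simp
  -- assemble
  have htri := abs_sub_le (Real.log (dirichletGreen V x y)) (Real.log (dirichletGreen Q x y))
    (Real.log (dirichletGreen V' (x + t) (y + t)))
  rw [abs_sub_comm (Real.log (dirichletGreen Q x y))] at htri
  have hfinal : (48980 + 2 * C₀) / M ^ 2 ≥ 2 * (C₀ / M ^ 2) := by
    rw [ge_iff_le, div_eq_mul_inv, div_eq_mul_inv]
    have : 0 ≤ (M ^ 2)⁻¹ := by positivity
    nlinarith
  linarith

/-! ### Registered sub-goal of the stub carried by this file -/

/-- **Sub-goal `s10_greenLocality`** (registered on stmt-CriticalPhenomena-14132): the Green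
half G1 of `stub_clusterLocalityV2` — Green-function locality at a flat boundary stretch, with
an absolute constant and rate `C/M²`, uniformly in the inner scale `m ≥ 1` and in the domains
beyond the flat balls (`green_locality`). [folklore] -/
theorem s10_greenLocality : ∃ C : ℝ, 0 < C ∧ ∀ (V V' : Finset (Literature.Probability.LatticeModels.Site 2)) (a a' x y : Literature.Probability.LatticeModels.Site 2) (m M : ℝ), 1 ≤ m → C ≤ M → (∀ v : Literature.Probability.LatticeModels.Site 2, (((v 0 - a 0) ^ 2 + (v 1 - a 1) ^ 2 : ℤ) : ℝ) ≤ (M * m) ^ 2 → (v ∈ V ↔ a 1 ≤ v 1)) → (∀ v : Literature.Probability.LatticeModels.Site 2, (((v 0 - a' 0) ^ 2 + (v 1 - a' 1) ^ 2 : ℤ) : ℝ) ≤ (M * m) ^ 2 → (v ∈ V' ↔ a' 1 ≤ v 1)) → x 1 = a 1 → y 1 = a 1 → (((x 0 - a 0) ^ 2 : ℤ) : ℝ) ≤ m ^ 2 → (((y 0 - a 0) ^ 2 : ℤ) : ℝ) ≤ m ^ 2 → 0 < Literature.Probability.LatticeModels.dirichletGreen V x y ∧ 0 < Literature.Probability.LatticeModels.dirichletGreen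 V' (x - a + a') (y - a + a') ∧ |Real.log (Literature.Probability.LatticeModels.dirichletGreen V x y) - Real.log (Literature.Probability.LatticeModels.dirichletGreen V' (x - a + a') (y - a + a'))| ≤ C / M ^ 2 :=
  green_locality

end Summit.CriticalPhenomena.CardyFormulaZ2.Cruxes.BoundaryDefectGaussianR.RainbowMonomialsInExcursionKernels

end
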